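import Mathlib.Algebra.Polynomial.Div
import Literature.Computability.AlgebraicComplexity.KoszulBorderRank
import HarnessLib

/-!
# The border substitution method for the algebraic border rank (Landsberg 2017, Prop. 5.4.1.3), one killed direction

Topic `Literature/Computability/AlgebraicComplexity`. Theorems only (no definitions, no named facts).
This is the first of the three ingredients of the proof of `16 ≤ bR(⟨3,3,3⟩)`
(`BorderRankMatMulThreeSixteen.lean`; Landsberg 2017, Thm. 5.4.5.1 = Landsberg–Michałek 2018,
Thm. 1.1, case `n = w = 3`, `m = 1`), for the tree's algebraic border rank `algBorderRank` over
`K[ε]` (Bläser 2013, Def. 6.1, `SchoenhageTau.lean`):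

* `koszulFlattening_restrict₁` — `K_Φ((P ⊗ 1 ⊗ 1) t) = K_{Φ ∘ P}(t)` (bookkeeping).
* `exists_ne_zero_algBorderRank_restrict₁_le` — **Prop. 5.4.1.3 with `a' = a − 1`**: if
  `bR(t) ≤ r + 1` then some non-zero `a₀ ∈ A` has `bR((P ⊗ 1 ⊗ 1) t) ≤ r` for every `P` with
  `P a₀ = 0` (every coordinate form of `T ↦ T/⟨a₀⟩ ∈ (A/⟨a₀⟩) ⊗ B ⊗ C`).  The printed proof takes the
  limit `A' = lim A'_t` in the Grassmannian; over `K[ε]` the limit is replaced by an explicit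
  `K[ε]`-linear change of the first factor that is the identity at `ε = 0` and sends the first
  vector `u₀(ε)` of an optimal approximate decomposition into `K[ε] · a₀`, `a₀` its lowest-order
  coefficient vector — so after `P` the first triad vanishes identically and `r` triads remain.
  This works over any field.
* `rank_koszulFlattening_le_of_forall_restrict₁` — the conclusion fed into Landsberg–Ottaviani's
  Koszul bound (`LandsbergOttaviani2015_thm21_algBorderRank`): for every `Φ : A → K^{2p+1}` with
  `Φ(a₀) = 0`, `rank K_Φ(t) ≤ binom(2p,p) · r`.

## References

* J. M. Landsberg, *Geometry and Complexity Theory*, CUP 2017 (held: `lit read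
  landsberg2017-geometry-complexity-theory`), §5.4.1, Prop. 5.4.1.3 [BL16, LM17b] and its proof
  (p. 126 of the held copy); §5.4.5, proof of Thm. 5.4.5.1, Parts 1–2 (pp. 133–134). [LandsbergGCT2017]
* J. M. Landsberg, M. Michałek, *A `2n² − log₂(n) − 1` lower bound for the border rank of matrix
  multiplication*, IMRN 2018, Thm. 1.1. [LandsbergMichalek2018]
* J. M. Landsberg, G. Ottaviani, Theory of Computing 11 (2015), Thm. 2.1. [LandsbergOttaviani2015]
* M. Bläser, *Fast Matrix Multiplication*, Theory of Computing Graduate Surveys 5 (2013), Def. 6.1. [Blaser2013]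
-/

noncomputable section

open scoped BigOperators Polynomial
open Matrix

namespace Literature.Computability.AlgebraicComplexity

universe w

/-! ## Linear maps in the first factor and Koszul flattenings -/

/-- Applying a matrix `P` in the first factor and then flattening after `Φ` is flattening after
`Φ ∘ P`. [folklore] -/
theorem koszulFlattening_restrict₁ {K : Type*} [CommRing K] (p : ℕ) {ι ι' κ μ : Type*} [Fintype ι]
    (Φ : (ι' → K) →ₗ[K] (Fin (2 * p + 1) → K)) (P : Matrix ι' ι K) (t : ι → κ → μ → K) :
    koszulFlattening p Φ (fun a' b c => ∑ a, P a' a * t a b c) =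
      koszulFlattening p (Φ ∘ₗ P.mulVecLin) t := by
  ext r c
  simp only [koszulFlattening_apply, LinearMap.comp_apply, Matrix.mulVecLin_apply]
  rfl

/-! ## The border substitution method, `a' = a − 1` (Landsberg 2017, Prop. 5.4.1.3), over `K[ε]` -/

/-- **Border substitution, one direction killed** (Landsberg 2017, Prop. 5.4.1.3 [BL16, LM17b] with
`a' = a − 1`, for the algebraic border rank over `K[ε]`): if `bR(t) ≤ r + 1` then there is a
non-zero `a₀` in the first factor such that for every matrix `P` with `P a₀ = 0` (in particular
every projection `A → A/⟨a₀⟩` written in coordinates) `bR((P ⊗ 1 ⊗ 1) t) ≤ r`.  Printed proof: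
"`T = lim T_t`, `T_t = ∑ a_j(t) ⊗ b_j(t) ⊗ c_j(t)` … let `A' = lim A'_t`"; here `a₀` is the lowest
`ε`-order coefficient vector of the first vector `u₀(ε)` of an optimal approximate decomposition,
and the limit is replaced by the explicit `K[ε]`-linear change of the first factor
`x ↦ q(a₁) x − x(a₁) (q − a₀)` (`u₀ = ε^d q`, `q(0) = a₀`, `a₀(a₁) ≠ 0`), which is `a₀(a₁) · id`
at `ε = 0` and maps `u₀` into `K[ε] · a₀`, so that after `P` the first triad disappears.
[cite: LandsbergGCT2017, Prop. 5.4.1.3 (p. 126 of the held copy)] -/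
theorem exists_ne_zero_algBorderRank_restrict₁_le {K : Type*} [Field K] {ι κ μ : Type*}
    [Fintype ι] [Fintype κ] [Fintype μ] [DecidableEq ι] [DecidableEq κ] [DecidableEq μ] [Nonempty ι]
    (t : ι → κ → μ → K) {r : ℕ} (hr : algBorderRank t ≤ r + 1) :
    ∃ a₀ : ι → K, a₀ ≠ 0 ∧ ∀ P : Matrix ι ι K, P *ᵥ a₀ = 0 →
      algBorderRank (fun a' b c => ∑ a, P a' a * t a b c) ≤ r := by
  classical
  obtain ⟨h, hh⟩ := exists_algBorderRank_eq_approxRank t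
  -- the easy case `bR(t) ≤ r`
  by_cases hle : algBorderRank t ≤ r
  · obtain ⟨i⟩ := ‹Nonempty ι›
    refine ⟨Pi.single i 1, fun h0 => ?_, fun P _ => (algBorderRank_restrict₁_le t P).trans hle⟩
    simpa using congrFun h0 i
  have hA : approxRank h t = r + 1 := by rw [← hh]; omega
  obtain ⟨u, v, w, huvw⟩ : ∃ (u : Fin (r + 1) → ι → K[X]) (v : Fin (r + 1) → κ → K[X])
      (w : Fin (r + 1) → μ → K[X]), IsApproxDecomposition h t u v w := by
    rw [← hA]
    exact exists_isApproxDecomposition_approxRank h t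
  -- the first vector `u 0` is non-zero, by minimality of `r + 1`
  have hu0 : u 0 ≠ 0 := by
    intro hu
    have hdec : IsApproxDecomposition h t (fun ρ => u ρ.succ) (fun ρ => v ρ.succ)
        (fun ρ => w ρ.succ) := by
      intro a b c j hj
      have := huvw a b c j hj
      rwa [Fin.sum_univ_succ, hu, Pi.zero_apply, zero_mul, zero_mul, zero_add] at this
    have := approxRank_le_of_isApproxDecomposition hdec
    omega
  -- `d` = the `ε`-adic order of `u 0`, `u 0 = ε^d q`, `a₀ = q(0) ≠ 0`
  have hex : ∃ d, ∃ a, (u 0 a).coeff d ≠ 0 := by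
    by_contra hno
    push Not at hno
    exact hu0 (funext fun a => Polynomial.ext fun d => by simpa using hno d a)
  set d := Nat.find hex with hd
  obtain ⟨a₁, ha₁⟩ : ∃ a, (u 0 a).coeff d ≠ 0 := Nat.find_spec hex
  have hdvd : ∀ a, Polynomial.X ^ d ∣ u 0 a := fun a =>
    Polynomial.X_pow_dvd_iff.2 fun d' hd' => by
      have := Nat.find_min hex (m := d') hd'
      push Not at this
      exact this a
  choose q hq using hdvd
  set a₀ : ι → K := fun a => (q a).coeff 0 with ha₀_def
  have hqa : ∀ a, (q a).coeff 0 = (u 0 a).coeff d := fun a => by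
    rw [hq a, Polynomial.coeff_X_pow_mul', if_pos le_rfl, Nat.sub_self]
  have hα : a₀ a₁ ≠ 0 := by
    simp only [ha₀_def, hqa]
    exact ha₁
  refine ⟨a₀, fun h0 => hα (by rw [h0]; rfl), fun P hP => ?_⟩
  -- the modified first vectors
  set α : K := a₀ a₁ with hα_def
  set cc : ι → K[X] := fun a => q a - Polynomial.C (a₀ a) with hcc
  set u' : Fin (r + 1) → ι → K[X] := fun ρ a' =>
    Polynomial.C α⁻¹ * ∑ a, Polynomial.C (P a' a) * (q a₁ * u ρ a - u ρ a₁ * cc a) with hu'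
  -- (A) the first new vector vanishes
  have hPa₀ : ∀ a', ∑ a, P a' a * a₀ a = 0 := fun a' => by
    have := congrFun hP a'
    simpa [Matrix.mulVec, dotProduct] using this
  have hA0 : ∀ a', u' 0 a' = 0 := by
    intro a'
    have h1 : ∀ a, Polynomial.C (P a' a) * (q a₁ * u 0 a - u 0 a₁ * cc a) =
        (Polynomial.X ^ d * q a₁) * Polynomial.C (P a' a * a₀ a) := by
      intro a
      rw [hq a, hq a₁, map_mul]
      simp only [hcc]
      ring
    simp only [hu', h1, ← Finset.mul_sum, ← map_sum, hPa₀ a', map_zero, mul_zero]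
  -- (B) the new vectors decompose `(P ⊗ 1 ⊗ 1) t` to order `h`
  have hB : IsApproxDecomposition h (fun a' b c => ∑ a, P a' a * t a b c) u' v w := by
    rw [isApproxDecomposition_iff] at huvw ⊢
    choose Q hQ hQ0 using huvw
    intro a' b c
    refine ⟨Polynomial.C α⁻¹ * ∑ a, Polynomial.C (P a' a) * (q a₁ * Q a b c - cc a * Q a₁ b c),
      ?_, ?_⟩
    · calc ∑ ρ, u' ρ a' * v ρ b * w ρ c
          = ∑ ρ, ∑ a, Polynomial.C α⁻¹ * (Polynomial.C (P a' a) *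
              (q a₁ * (u ρ a * v ρ b * w ρ c) - cc a * (u ρ a₁ * v ρ b * w ρ c))) := by
            refine Finset.sum_congr rfl fun ρ _ => ?_
            simp only [hu', Finset.mul_sum, Finset.sum_mul]
            refine Finset.sum_congr rfl fun a _ => ?_
            ring
        _ = ∑ a, Polynomial.C α⁻¹ * (Polynomial.C (P a' a) *
              (q a₁ * (∑ ρ, u ρ a * v ρ b * w ρ c) - cc a * (∑ ρ, u ρ a₁ * v ρ b * w ρ c))) := by
            rw [Finset.sum_comm]
            refine Finset.sum_congr rfl fun a _ => ?_
            rw [← Finset.mul_sum, ← Finset.mul_sum]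
            congr 2
            rw [Finset.sum_sub_distrib, Finset.mul_sum, Finset.mul_sum]
        _ = Polynomial.X ^ h * (Polynomial.C α⁻¹ *
              ∑ a, Polynomial.C (P a' a) * (q a₁ * Q a b c - cc a * Q a₁ b c)) := by
            simp only [hQ, Finset.mul_sum]
            refine Finset.sum_congr rfl fun a _ => ?_
            ring
    · have hq1 : (q a₁).coeff 0 = α := rfl
      have hcc0 : ∀ a, (cc a).coeff 0 = 0 := fun a => by
        simp [hcc, ha₀_def]
      simp only [Polynomial.coeff_C_zero, Polynomial.finsetSum_coeff, Polynomial.coeff_sub,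
        Polynomial.mul_coeff_zero, hq1, hcc0, hQ0, zero_mul, sub_zero, Finset.mul_sum]
      refine Finset.sum_congr rfl fun a _ => ?_
      field_simp
  -- drop the vanishing first triad
  have hB' : IsApproxDecomposition h (fun a' b c => ∑ a, P a' a * t a b c) (fun ρ => u' ρ.succ)
      (fun ρ => v ρ.succ) (fun ρ => w ρ.succ) := by
    intro a b c j hj
    have := hB a b c j hj
    rwa [Fin.sum_univ_succ, hA0, zero_mul, zero_mul, zero_add] at this
  exact (algBorderRank_le_approxRank h _).trans (approxRank_le_of_isApproxDecomposition hB')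

/-! ## From the border substitution datum to a Koszul rank bound -/

/-- **Koszul flattenings of the reduced tensor** (Landsberg 2017, proof of Thm. 5.4.5.1, Part 2:
"it will suffice to apply the Koszul flattening to `M^λ`"): if every `P` killing `n₀` has
`bR((P ⊗ 1 ⊗ 1) t) ≤ r`, then for every `Φ : A → K^{2p+1}` vanishing on `n₀` (i.e. factoring
through `A/⟨n₀⟩`) `rank K_Φ(t) ≤ binom(2p,p) · r`: take `P = 1 − n₀ ⊗ e_{i₀}^*` (`n₀(i₀) = 1`),
so `Φ ∘ P = Φ`, `K_Φ(t) = K_Φ((P ⊗ 1 ⊗ 1) t)`, and apply Landsberg–Ottaviani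
(`LandsbergOttaviani2015_thm21_algBorderRank`). [cite: LandsbergGCT2017, proof of Thm. 5.4.5.1, Part 2]
[cite: LandsbergOttaviani2015, Thm 2.1] -/
theorem rank_koszulFlattening_le_of_forall_restrict₁ {K : Type*} [Field K] {ι : Type*} {κ μ : Type w}
    [Fintype ι] [Fintype κ] [Fintype μ] [DecidableEq ι] [DecidableEq κ] [DecidableEq μ] (p : ℕ)
    (Φ : (ι → K) →ₗ[K] (Fin (2 * p + 1) → K)) (t : ι → κ → μ → K) (n₀ : ι → K) (i₀ : ι)
    (hi₀ : n₀ i₀ = 1) (hΦ : Φ n₀ = 0) {r : ℕ}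
    (hP : ∀ P : Matrix ι ι K, P *ᵥ n₀ = 0 →
      algBorderRank (fun a' b c => ∑ a, P a' a * t a b c) ≤ r) :
    (koszulFlattening p Φ t).rank ≤ (2 * p).choose p * r := by
  classical
  let P : Matrix ι ι K := 1 - Matrix.of fun a' a => if a = i₀ then n₀ a' else 0
  have hPv : ∀ x : ι → K, P *ᵥ x = x - x i₀ • n₀ := by
    intro x
    funext a'
    change ((1 - Matrix.of fun a' a => if a = i₀ then n₀ a' else 0) *ᵥ x) a' = x a' - x i₀ * n₀ a'
    rw [Matrix.sub_mulVec, Matrix.one_mulVec, Pi.sub_apply]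
    congr 1
    simp only [Matrix.mulVec, dotProduct, Matrix.of_apply, ite_mul, zero_mul, Finset.sum_ite_eq',
      Finset.mem_univ, if_true]
    ring
  have hP₀ : P *ᵥ n₀ = 0 := by
    rw [hPv, hi₀, one_smul, sub_self]
  have hΦP : Φ ∘ₗ P.mulVecLin = Φ := by
    refine LinearMap.ext fun x => ?_
    rw [LinearMap.comp_apply, Matrix.mulVecLin_apply, hPv, map_sub, map_smul, hΦ, smul_zero,
      sub_zero]
  have h1 := koszulFlattening_restrict₁ p Φ P t
  rw [hΦP] at h1
  rw [← h1]
  exact (LandsbergOttaviani2015_thm21_algBorderRank p Φ _).trans (Nat.mul_le_mul_left _ (hP P hP₀))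

end Literature.Computability.AlgebraicComplexity

end
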